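import Summits.BirchSwinnertonDyer.Rank1Residual.X4.KuriharaLowerHalf
import Summits.BirchSwinnertonDyer.Rank1Residual.Supersingular.SurjSerreCertificateShape
import Summits.BirchSwinnertonDyer.Rank1Residual.Supersingular.RankOneRem13RecordShapesCount
import Summits.BirchSwinnertonDyer.Rank1Residual.Additive.X4ThreeKuriharaCertKernel
import Summits.BirchSwinnertonDyer.Rank1Residual.X11b.KrausMinimalityGeneralTwo
import Literature.NumberTheory.EllipticCurves.ManinConstantConductorLe300000
import Summits.BirchSwinnertonDyer.Rank1Residual.Additive.GordCycLeadingTermSemistableTwist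
import Summits.BirchSwinnertonDyer.Rank1Residual.SecondDescent.X10aPrimeTargetsKernelCertificates
import Summits.BirchSwinnertonDyer.Rank1Residual.Additive.X4ThreeResCertKernel
import Summits.BirchSwinnertonDyer.Rank1Residual.Additive.N10IsogenyTransport
import HarnessLib

/-!
# Route `AdditiveBranchIMC` (rung K1, cell `bsd-addord`), crux `GordTwoRankZeroOffCaseOne`
# (item stmt-BirchSwinnertonDyer-19357), registered half-crux stub `stub_irreducible` — PER-ROW RECORDS 06:
# Kurihara-number (Kim 2026 Thm 1.8 (6)) certificates on the SURJECTIVE content rows of cell (G-ord, e = 2) at `p ≥ 5`,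
# surjectivity and the Kolyvagin level IN THE KERNEL, the Kurihara VALUE an EVIDENCE binder
# (a `--supports stmt-BirchSwinnertonDyer-19357 --as helper` file; seat `bsd-addord-k1-c2x` (lane B), gen 5)

HONEST FRAMING. Per-row instances of the crux's conclusion `MissingLowerBoundAt W p`
(L₀ = `ord_p #Ш_an ≤ ord_p #Ш`) on rows of `stub_irreducible`'s domain (`r_an = 0`, `N10.CellGordTwo`, `E[p]`
irreducible — here `ρ̄` onto); CONDITIONAL on named PUBLISHED inputs; the class-wide stub and the crux stay
OPEN; nothing is booked by this file (booking is referee A's); BSD is not proved by any of this.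

Rows in this file: `423475h1`@5 (n = 61·151), `290325bm1`@7 (n = 197·239).

ROAD (the one lane A of this crux is NOT on; PUBLISHED, no reduction hypothesis at `p`): C.-H. Kim,
Amer. J. Math. 148 (2026) Thm 1.8 (6) (= arXiv:2203.12159 Thm 1.9 (6)) — in analytic rank `0` with `ρ̄_{E,p}`
onto and the Manin constant prime to `p`, ONE unit Kurihara number `δ̃_n ≢ 0 (mod p)` at a cyclic Kolyvagin
level gives `length Ш(E/ℚ)[p^∞] ≥ ord_p(L(E,1)/Ω_E)`, i.e. the LOWER half. On cell (G-ord, e = 2) (Kodaira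
I₀*, `E = V ⊗ χ_{p*}` with `V` good ordinary at `p`) the local torsion `E(ℚ_p)[p]` is trivial at `p ≥ 5`
(`E ≅ V` over `ℚ_p(√p*)`, `e = 2 < p − 1`, and Gal acts by `−1`; = Kim Prop 3.2: `a₄ ≢ 10 (25)` /
`a₆ ≢ 14 (49)` on the twisted model), so a DEPTH-ONE certificate (`ℓᵢ ≡ 1`, `a_ℓ ≡ ℓ + 1 (mod p)`) is the
printed case `t = 0` (no `K26-(6)-shallow@t>0` issue). The tree's additive Kurihara records (`X4/KimAdditiveRecords*`,
T-KIMADD) stop at `N ≤ 129 850` and cell `bsd-potss` (seats kt-kur5/5b) certified the potentially SUPERSINGULAR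
rows; the potentially ORDINARY `e = 2` rows at `N > 130 000` of this crux were in no Kurihara universe before.

RECORD SHAPE = cell `bsd-potss`'s p458600 `Theorems.tameMissingLowerBoundAt_rankZero_of_intModel_of_serre_of_pair`,
inlined exactly as in its record files `KatoDescentTamePotSupersingularTameLowerOffSeedKuriharaRecordsNN` through
`X4.missingLowerBoundAt_rankZero_of_kimLower` + `X4.periodTransfer_of_optimal` (nothing cell-specific enters):
`MissingLowerBoundAt W p` for Cremona's LITERAL minimal model, from
* IN THE KERNEL (`decide` on Cremona's coefficients): `Δ ≠ 0`; global minimality (x11c's bounded / support Kraus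
  criterion); surjectivity of `ρ̄_{E,p}` from THREE Serre Prop-19 witnesses (`Supersingular.surj_of_ainvs_of_serreWitnesses`,
  schema point counts `countPoints`); the level `n = ℓ₁ℓ₂ ∈ 𝒩₁(E,p)` — `ℓᵢ ∤ Δ`, `ℓᵢ ≡ 1 (mod p)`,
  `p ∣ #Ẽ(𝔽_{ℓᵢ})` — and the cyclicity binder `#Ẽ(𝔽_{ℓᵢ})[p] ≤ p` from `p² ∤ #Ẽ(𝔽_{ℓᵢ})` (schema point
  counts; a count at a prime `ℓ > 1000` is a DATA binder `hcount`);
* NAMED PUBLISHED INPUTS in hypothesis position: Kim 2026 Thm 1.8 (6) (`hKim`, tree fact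
  `Kim2026.rankZero_le_padicValNat_sha_of_kuriharaNumber_ne_zero`, NO reduction hypothesis at `p`), GZK (`hGZK`),
  modularity (`hmod`), Cremona's Manin-constant computation to `300000` (`h300`; rows with `N > 300000` carry
  `hc : p ∤ c_D` instead — Cremona `opt_man`: optimality code 1, `c = 1` on every row of this file);
* EVIDENCE binders per row: `r_an = 0` (`hr`; Cremona), the OPTIMAL datum at level `N` (`D`, `hopt`; Cremona's
  curve `…1`, optimality code 1), and the VALUE `hδ : ∃ ψ, δ̃_n ≢ 0 (mod p)` at the NAMED level — TWO engines of
  DIFFERENT method at the SAME level: engine 1 = kit kit j286086 (cell `bsd-potss` seat kt-kur5's `kt5_engineBf.py`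
  sha16 c8f8fa3338435b75 BYTE-IDENTICAL: numerical modular symbols at level `N` by the harvest-2 ENGINE-B formulas, exact
  rationals certified by the exact Hecke relations — 0 failures — and `[0]⁺ = #Ш_an·∏c_ℓ/#E(ℚ)²_tors` exactly);
  engine 2 = kit kit j288123 (cell `b2b-bsdres` additive-p4 GEN22 line V41 `twist41.gp` sha16 f596fb048fb0d05c BYTE-IDENTICAL:
  EXACT modular symbols of the good ordinary twist `V = E^{(p*)}` at level `N/p²` by PARI `msfromell` + Birch
  twisting `[r]⁺_E = c·Σ_u (p*/u)[r + u/p]^±_V`, `|c|_p = 1`; no numerics); per-row provenance in each docstring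
  and in the item's evidence `CERTS-k1c2x-g5.tsv`.

References: [Kim2022StructureSelmer] Thm. 1.9 (6), §1.2.2, §1.3.5, §1.4.3, Prop. 3.2 (= Amer. J. Math. 148 (2026) Thm. 1.8);
[Serre1972] §2.8 Prop. 19; [AgasheRibetStein2006] Thm. 2.6; [CesnaviciusNeururerSaha2023] §1; [Cremona1997] §2.8, Table 1;
[Pal2012] (period ratio of a quadratic twist); [SilvermanAEC2009] VII.1; [Kraus1989]; [Miller2011LMS] Def. 1.1.
-/

set_option autoImplicit false
-- precedent (`KatoDescentTamePotSupersingularTameLowerOffSeedKuriharaRecords33.lean`): the directory name repeats the summit name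
set_option linter.dupNamespace false

noncomputable section

open scoped Classical MatrixGroups ModularForm

namespace Summit.BirchSwinnertonDyer.BirchSwinnertonDyer.Theorems.AdditiveBranchIMCGordTwoRankZeroKurihara

open CongruenceSubgroup WeierstrassCurve Literature.NumberTheory.EllipticCurves
  Literature.NumberTheory.EllipticCurves.ModularForms
  Literature.NumberTheory.EllipticCurves.Rank1Residual
  Literature.NumberTheory.EllipticCurves.Rank1Residual.Typed
  Literature.NumberTheory.EllipticCurves.Rank1Residual.X11RankOneCertificates
  Summit.BirchSwinnertonDyer.Rank1Residual
  Summit.BirchSwinnertonDyer.Rank1Residual.Additive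
  Summit.BirchSwinnertonDyer.Rank1Residual.X4
  Summit.BirchSwinnertonDyer.Rank1Residual.X11b
  Summit.BirchSwinnertonDyer.Rank1Residual.Supersingular
  Summit.BirchSwinnertonDyer.BirchSwinnertonDyer.Rank1Residual.IntModel
  Summit.BirchSwinnertonDyer.BirchSwinnertonDyer.Rank1Residual.X11RankOne

-- `decide` evaluates `discOf`/`c4Of`/`c6Of`, the Kraus tests and the schema point counts on the literal coefficients
set_option maxRecDepth 100000 in
set_option maxHeartbeats 1000000 in
/-- **L₀ = `ord_5 #Ш_an ≤ ord_5 #Ш` for `423475h1`** (Cremona's minimal model `[0, -1, 1, -7658, -255407]`, `N = 423475 = 5²·16939`; additive potentially GOOD ORDINARY with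
semistability defect `e = 2` at `5` (Kodaira I₀*, cell `N10.CellGordTwo`, `E = V ⊗ χ_{5}` with `V` good ordinary of conductor `16939`); `r_an = 0`, `#Ш_an = 25`, `∏ c_ℓ = 1`, `#E(ℚ)_tors = 1`;
class of 1 curve(s), `5 ∣ #Ш_an` on every member; crux 19357 content row of the A2 R823 residue; NO record of any kind for this row before (lane A: no rank-2 congruent partner in Cremona or in the Hesse-pencil waves)).
IN THE KERNEL: minimality (bounded Kraus form); `Δ ≠ 0`; `ρ̄_{E,5}` onto by Serre Prop. 19 witnesses (i) `q = 7`: `#Ẽ = 11`, `a = -3`, `a² − 4q ≡ 4²`,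
(ii) `q = 3`: `#Ẽ = 2`, `a = 2`, Euler `−1`, (iii) `q = 3`: `#Ẽ = 2`, `a = 2`, `u = 3`; the level `n = 61·151 = 9211 ∈ 𝒩₁(E,5)`:
`#Ẽ(𝔽_{61}) = 60` (kernel), `#Ẽ(𝔽_{151}) = 140` (kernel), both `≡ 0 (mod 5)`, `≢ 0 (mod 5²)`
(cyclic `5`-torsion).
EVIDENCE (value binder `hδ`): `δ̃_{9211} ≡ 3 (mod 5)` — engine 1 = Bf kit j286086 (`D = 2`, rounding deviation `1.1e-09`, exact Hecke relations `210`/0 failed,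
`[0]⁺ = 25` = BSD value); engine 2 (V41 exact twist, SAME level): kit j288123 N0=16939, δ̃_{9211} ≡ 3·c with c = 1 (|c|_5 = 1, exact from [0]), i.e. ≡ 3 (mod 5) — AGREE; V41 values {"9211": "3"}. Local torsion `E(ℚ_5)[5] = 0` (I₀* twist, `t = 0`: depth-one level is the printed case). Manin: `N > 300000`: `5 ∤ c_D` is the DISPLAYED binder `hc` (Cremona: optimal curve, `c = 1`, DATA).
CONDITIONAL on `hKim` (Kim 2026 Thm. 1.8 (6), PUBLISHED), GZK, modularity, the Manin binder `hc`; per-row instance of crux 19357's conclusion on a `stub_irreducible` row; NOT a class theorem; nothing booked.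
[cite: Kim2022StructureSelmer, Thm. 1.9 (6) (PDF p. 8), §1.2.2, §1.4.3] [cite: Serre1972, §2.8 Prop. 19] [cite: Cremona1997, Table 1 (label 423475h1), §2.8] [cite: Miller2011LMS, Def. 1.1] -/
theorem gordTwoLower_kur_v423475h1_5 (hKim : Kim2026.rankZero_le_padicValNat_sha_of_kuriharaNumber_ne_zero)
    (hGZK : rank_eq_analyticRank_of_analyticRank_le_one) (hmod : hasEntireLFunction_rat)
    (W : WeierstrassCurve ℚ) (hW : W = ⟨0, -1, 1, -7658, -255407⟩)
    (hr : W.analyticRank = 0) (D : ModularParametrizationData W 423475)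
    (hopt : ∀ z ∈ D.L.lattice, ∃ w ∈ periodLattice D.f, z = D.c * w)
    (hc : ¬ ((5 : ℕ) : ℤ) ∣ D.maninConstant)
    (hδ : ∃ ψ : (ℓ : ℕ) → (ZMod ℓ)ˣ →* Multiplicative (ZMod (5 ^ 1)),
      (∀ ℓ ∈ (61 * 151 : ℕ).primeFactors, Function.Surjective (ψ ℓ)) ∧ kuriharaNumber D.f (5 ^ 1) (61 * 151) ψ ≠ 0) :
    MissingLowerBoundAt W 5 := by
  subst hW
  have hmin : (⟨0, -1, 1, -7658, -255407⟩ : WeierstrassCurve ℚ).IsGloballyMinimal :=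
    isGloballyMinimal_of_krausCriterion_bounded 0 (-1) 1 (-7658) (-255407)
      (by decide +kernel) (by decide +kernel) (by decide +kernel)
  haveI := hmin
  haveI : (⟨0, -1, 1, -7658, -255407⟩ : WeierstrassCurve ℚ).IsElliptic := isElliptic_of_discOf_ne_zero 0 (-1) 1 (-7658) (-255407) (by decide +kernel)
  have hI : integralModelInt (⟨0, -1, 1, -7658, -255407⟩ : WeierstrassCurve ℚ) = (⟨0, -1, 1, -7658, -255407⟩ : WeierstrassCurve ℤ) :=
    integralModelInt_eq_of_map_eq _ (map_mk_int 0 (-1) 1 (-7658) (-255407))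
  have hsurj : Surj (⟨0, -1, 1, -7658, -255407⟩ : WeierstrassCurve ℚ) 5 :=
    @surj_of_ainvs_of_serreWitnesses 0 (-1) 1 (-7658) (-255407) 5 ⟨by norm_num⟩ (by norm_num) hmin
      7 3 3 (by norm_num) (by norm_num) (by norm_num) (by decide) (by decide) (by decide)
      (by decide) (by decide) (by decide) (by decide +kernel) (by decide +kernel) (by decide +kernel)
      (n₁ := 11) (n₂ := 2) (n₃ := 2) (by decide +kernel) (by decide +kernel) (by decide +kernel)
      (4 : ZMod 5) (3 : ZMod 5) (by decide +kernel) (by decide +kernel) (by decide +kernel)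
  -- the `Fact p.Prime` instance enters only now: the `decide` goals above must be closed terms
  haveI hp : Fact (Nat.Prime 5) := ⟨by norm_num⟩
  haveI : Fact (Nat.Prime 61) := ⟨by norm_num⟩
  haveI : Fact (Nat.Prime 151) := ⟨by norm_num⟩
  have hc₁ := natCard_point_eq_of_countPoints 0 (-1) 1 (-7658) (-255407) 61 (by norm_num) (by decide +kernel) (n := 60) (by decide +kernel)
  have hc₂ := natCard_point_eq_of_countPoints 0 (-1) 1 (-7658) (-255407) 151 (by norm_num) (by decide +kernel) (n := 140) (by decide +kernel)
  have hk₁ : Kato.IsKolyvaginPrime (⟨0, -1, 1, -7658, -255407⟩ : WeierstrassCurve ℚ) 5 1 61 :=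
    isKolyvaginPrime_of_intModel_of_card hI 5 1 61 (by norm_num) (by rw [intCurve_Δ]; decide +kernel) (by decide) hc₁ (by norm_num)
  have hk₂ : Kato.IsKolyvaginPrime (⟨0, -1, 1, -7658, -255407⟩ : WeierstrassCurve ℚ) 5 1 151 :=
    isKolyvaginPrime_of_intModel_of_card hI 5 1 151 (by norm_num) (by rw [intCurve_Δ]; decide +kernel) (by decide) hc₂ (by norm_num)
  haveI : NeZero (61 * 151 : ℕ) := ⟨by norm_num⟩
  obtain ⟨ψ, hψ, hδ⟩ := hδ
  exact X4.missingLowerBoundAt_rankZero_of_kimLower _ 5 hKim hGZK (by norm_num) hsurj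
    (((⟨0, -1, 1, -7658, -255407⟩ : WeierstrassCurve ℚ).analyticRank_eq_zero_iff_holds (hmod _)).mp hr) D hc (periodTransfer_of_optimal 5 D hopt hc)
    1 (61 * 151) le_rfl (Nat.le_add_left 1 _) (isKolyvaginProduct_mul hk₁ hk₂ (by norm_num))
    (forall_card_torsion_le_of_pair hI 5 61 151 hc₁ hc₂ (by norm_num) (by norm_num)) ψ hψ hδ

/-- **`BSD(E,5)` for `E = 423475h1`** from the Kurihara certificate: LOWER half = `gordTwoLower_kur_v423475h1_5` (Kim 2026 Thm 1.8 (6), this file);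
UPPER half = the cell's semistable-twist door `Addv.missingUpperBoundAt_rankZero_of_semistableTwist_of_surj` (Kato 2004 Thm 17.4 (3) in Wuthrich's
half-eigenspace reading `hK`, Delbourgo 1998 Prop 4 `hDel98`, Pal 2012 `hPal`, modularity `hmod`/`hmodD`; NO Tamagawa / Manin / partner hypothesis) with,
IN THE KERNEL, `Addv W 5` (`5 ∣ Δ`, `5 ∣ c₄`), the twist model `V = [0, 1, 1, -306, -2166]` (`= E^{(5)}` minimal, conductor `16939`: `Δ ≠ 0`, bounded Kraus form; `#Ṽ(𝔽_5) = 7`, `a_5 = -1`: good ORDINARY at `5`) and the explicit isomorphism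
`⟨1, -2, 0, 1/2⟩ • V^{(5)} = W` — i.e. the row lies in cell (G-ord, e = 2) = `N10.CellGordTwo` (crux 19357's domain, stub `stub_irreducible`).
Binders = those of `gordTwoLower_kur_v423475h1_5` + `hK hDel98 hPal hmodD`. Booking-table currency shape of lane A's `bsdp_c<E>_<p>` with the certificate
binder `hδ` (Kurihara VALUE, two engines) in place of `θ` / `hSel`. Per row; NOT a class theorem; nothing booked. BSD is not proved by any of this.
[cite: Kim2022StructureSelmer, Thm. 1.9 (6) (PDF p. 8)] [cite: Kato2004Asterisque, Thm. 17.4 (3) (p. 273)] [cite: Wuthrich2014, §3 (p. 390)] [cite: Delbourgo1998, Prop. 4 (p. 144)]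
[cite: Pal2012, Thm. 3.2] [cite: Miller2011LMS, §1 and Def. 1.1] [cite: Cremona1997, Table 1 (label 423475h1)] -/
theorem gordTwoBsdp_kur_v423475h1_5 (hKim : Kim2026.rankZero_le_padicValNat_sha_of_kuriharaNumber_ne_zero)
    (hGZK : rank_eq_analyticRank_of_analyticRank_le_one) (hmod : hasEntireLFunction_rat)
    (hK : Wuthrich2014.kato_halfEigenCharIdeal_dvd_cyclotomicPrime_of_surjective)
    (hDel98 : Delbourgo1998.prop4_rankZero_pow_dvd_constantCoeff)
    (hPal : Pal2012.thm32_sqrt_mul_realPeriodRat_twist_eq_of_prime_one_mod_four)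
    (hmodD : nonempty_modularParametrizationData)
    (W : WeierstrassCurve ℚ) [W.IsElliptic] [W.IsGloballyMinimal] (hW : W = ⟨0, -1, 1, -7658, -255407⟩)
    (hr : W.analyticRank = 0) (D : ModularParametrizationData W 423475)
    (hopt : ∀ z ∈ D.L.lattice, ∃ w ∈ periodLattice D.f, z = D.c * w)
    (hc : ¬ ((5 : ℕ) : ℤ) ∣ D.maninConstant)
    (hδ : ∃ ψ : (ℓ : ℕ) → (ZMod ℓ)ˣ →* Multiplicative (ZMod (5 ^ 1)),
      (∀ ℓ ∈ (61 * 151 : ℕ).primeFactors, Function.Surjective (ψ ℓ)) ∧ kuriharaNumber D.f (5 ^ 1) (61 * 151) ψ ≠ 0) :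
    BSDp W 5 := by
  have hlow : MissingLowerBoundAt W 5 :=
    gordTwoLower_kur_v423475h1_5 hKim hGZK hmod W hW hr D hopt hc hδ
  subst hW
  have hminW : (⟨0, -1, 1, -7658, -255407⟩ : WeierstrassCurve ℚ).IsGloballyMinimal :=
    isGloballyMinimal_of_krausCriterion_bounded 0 (-1) 1 (-7658) (-255407)
      (by decide +kernel) (by decide +kernel) (by decide +kernel)
  have hIW : integralModelInt (⟨0, -1, 1, -7658, -255407⟩ : WeierstrassCurve ℚ) = (⟨0, -1, 1, -7658, -255407⟩ : WeierstrassCurve ℤ) :=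
    integralModelInt_eq_of_map_eq _ (map_mk_int 0 (-1) 1 (-7658) (-255407))
  have hsurj : Surj (⟨0, -1, 1, -7658, -255407⟩ : WeierstrassCurve ℚ) 5 :=
    @surj_of_ainvs_of_serreWitnesses 0 (-1) 1 (-7658) (-255407) 5 ⟨by norm_num⟩ (by norm_num) hminW
      7 3 3 (by norm_num) (by norm_num) (by norm_num) (by decide) (by decide) (by decide)
      (by decide) (by decide) (by decide) (by decide +kernel) (by decide +kernel) (by decide +kernel)
      (n₁ := 11) (n₂ := 2) (n₃ := 2) (by decide +kernel) (by decide +kernel) (by decide +kernel)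
      (4 : ZMod 5) (3 : ZMod 5) (by decide +kernel) (by decide +kernel) (by decide +kernel)
  -- the `Fact p.Prime` instance enters only now: the `decide` goals above must be closed terms
  haveI hp : Fact (Nat.Prime 5) := ⟨by norm_num⟩
  -- the good ordinary twist model V = E^(5) (PARI ellminimalmodel(elltwist(E,5)) = Connell's formulas on (c₄/p², ±c₆/p³)): Δ ≠ 0, Kraus minimality, GoodOrd at p — all kernel
  haveI hVell : (⟨0, 1, 1, -306, -2166⟩ : WeierstrassCurve ℚ).IsElliptic := isElliptic_of_discOf_ne_zero 0 1 1 (-306) (-2166) (by decide +kernel)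
  haveI hVmin : (⟨0, 1, 1, -306, -2166⟩ : WeierstrassCurve ℚ).IsGloballyMinimal :=
    isGloballyMinimal_of_krausCriterion_bounded 0 1 1 (-306) (-2166)
    (by decide +kernel) (by decide +kernel) (by decide +kernel)
  have hVI : integralModelInt (⟨0, 1, 1, -306, -2166⟩ : WeierstrassCurve ℚ) = (⟨0, 1, 1, -306, -2166⟩ : WeierstrassCurve ℤ) :=
    integralModelInt_eq_of_map_eq _ (map_mk_int 0 1 1 (-306) (-2166))
  have hVc : Nat.card (((⟨0, 1, 1, -306, -2166⟩ : WeierstrassCurve ℤ).map (Int.castRingHom (ZMod 5))).toAffine.Point) = 7 := by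
    have h := natCard_point_eq_countPoints 0 1 1 (-306) (-2166) 5 (by norm_num) (by decide +kernel)
    have h' : countPoints [0, 1, 1, -306, -2166] 5 = 7 := by decide +kernel
    exact_mod_cast h.trans h'
  have hVgood : GoodOrd (⟨0, 1, 1, -306, -2166⟩ : WeierstrassCurve ℚ) 5 := SecondDescent.goodOrd_of_intModel 5 hVI (by decide +kernel) hVc (by decide)
  have hadd : Addv (⟨0, -1, 1, -7658, -255407⟩ : WeierstrassCurve ℚ) 5 := Additive.addv_of_intModel hIW 5 (by decide +kernel) (by decide +kernel)
  have hWV : (⟨1, (-2 : ℚ), (0 : ℚ), ((1 : ℚ) / 2)⟩ : VariableChange ℚ) • (⟨0, 1, 1, -306, -2166⟩ : WeierstrassCurve ℚ).quadraticTwist ((-1 : ℚ) ^ (5 / 2) * 5) = (⟨0, -1, 1, -7658, -255407⟩ : WeierstrassCurve ℚ) := by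
    ext <;> simp [WeierstrassCurve.variableChange_a₁, WeierstrassCurve.variableChange_a₂,
      WeierstrassCurve.variableChange_a₃, WeierstrassCurve.variableChange_a₄, WeierstrassCurve.variableChange_a₆,
      WeierstrassCurve.quadraticTwist, WeierstrassCurve.b₂, WeierstrassCurve.b₄, WeierstrassCurve.b₆] <;> norm_num
  exact bsdp_of_missingPPartAt _ 5 hGZK (by rw [hr]; norm_num)
    (missingPPartAt_of_lower_of_upper _ 5 hlow
      (Addv.missingUpperBoundAt_rankZero_of_semistableTwist_of_surj hK hDel98 hPal hGZK hmod hmodD (by norm_num)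
        hadd (⟨0, 1, 1, -306, -2166⟩ : WeierstrassCurve ℚ) (⟨1, (-2 : ℚ), (0 : ℚ), ((1 : ℚ) / 2)⟩ : VariableChange ℚ) hWV (Or.inl hVgood) hsurj hr))

/-- **`BSD(E',5)` for every globally minimal `E'` `ℚ`-isogenous to `E = 423475h1`** (Cremona class of 1 curve(s)): Cassels' invariance (`hCassels`,
`N10.bsdp_of_isIsogenous_of_bsdp`) on `gordTwoBsdp_kur_v423475h1_5`. Per class; nothing booked. [cite: MilneADT2006, Thm. I.7.3 and Remark I.7.4]
[cite: Kim2022StructureSelmer, Thm. 1.9 (6) (PDF p. 8)] [cite: Kato2004Asterisque, Thm. 17.4 (3) (p. 273)] [cite: Miller2011LMS, §1 and Def. 1.1] -/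
theorem isogenous_gordTwoBsdp_kur_v423475h1_5 (hCassels : bsdRHS_eq_of_isIsogenous)
    (hKim : Kim2026.rankZero_le_padicValNat_sha_of_kuriharaNumber_ne_zero)
    (hGZK : rank_eq_analyticRank_of_analyticRank_le_one) (hmod : hasEntireLFunction_rat)
    (hK : Wuthrich2014.kato_halfEigenCharIdeal_dvd_cyclotomicPrime_of_surjective)
    (hDel98 : Delbourgo1998.prop4_rankZero_pow_dvd_constantCoeff)
    (hPal : Pal2012.thm32_sqrt_mul_realPeriodRat_twist_eq_of_prime_one_mod_four)
    (hmodD : nonempty_modularParametrizationData)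
    (W : WeierstrassCurve ℚ) [W.IsElliptic] [W.IsGloballyMinimal] (hW : W = ⟨0, -1, 1, -7658, -255407⟩)
    (hr : W.analyticRank = 0) (D : ModularParametrizationData W 423475)
    (hopt : ∀ z ∈ D.L.lattice, ∃ w ∈ periodLattice D.f, z = D.c * w)
    (hc : ¬ ((5 : ℕ) : ℤ) ∣ D.maninConstant)
    (hδ : ∃ ψ : (ℓ : ℕ) → (ZMod ℓ)ˣ →* Multiplicative (ZMod (5 ^ 1)),
      (∀ ℓ ∈ (61 * 151 : ℕ).primeFactors, Function.Surjective (ψ ℓ)) ∧ kuriharaNumber D.f (5 ^ 1) (61 * 151) ψ ≠ 0)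
    {W' : WeierstrassCurve ℚ} [W'.IsElliptic] [W'.IsGloballyMinimal] (hiso : IsIsogenous W' W) :
    BSDp W' 5 := by
  haveI : Fact (Nat.Prime 5) := ⟨by norm_num⟩
  have hr' : W'.analyticRank ≤ 1 := by rw [analyticRank_eq_of_isIsogenous' hiso, hr]; exact zero_le_one
  exact N10.bsdp_of_isIsogenous_of_bsdp 5 hCassels hGZK hmod hiso hr'
    (gordTwoBsdp_kur_v423475h1_5 hKim hGZK hmod hK hDel98 hPal hmodD W hW hr D hopt hc hδ)

-- `decide` evaluates `discOf`/`c4Of`/`c6Of`, the Kraus tests and the schema point counts on the literal coefficients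
set_option maxRecDepth 100000 in
set_option maxHeartbeats 1000000 in
/-- **L₀ = `ord_7 #Ш_an ≤ ord_7 #Ш` for `290325bm1`** (Cremona's minimal model `[1, 1, 0, 158661975, -1853359409250]`, `N = 290325 = 7²·5925`; additive potentially GOOD ORDINARY with
semistability defect `e = 2` at `7` (Kodaira I₀*, cell `N10.CellGordTwo`, `E = V ⊗ χ_{-7}` with `V` good ordinary of conductor `5925`); `r_an = 0`, `#Ш_an = 49`, `∏ c_ℓ = 2`, `#E(ℚ)_tors = 1`;
class of 1 curve(s), `7 ∣ #Ш_an` on every member; crux 19357 content row of the A2 R823 residue; NO record of any kind for this row before (lane A: no rank-2 congruent partner; X_E(7) searches empty)).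
IN THE KERNEL: minimality (bounded Kraus form); `Δ ≠ 0`; `ρ̄_{E,7}` onto by Serre Prop. 19 witnesses (i) `q = 17`: `#Ẽ = 21`, `a = -3`, `a² − 4q ≡ 5²`,
(ii) `q = 11`: `#Ẽ = 11`, `a = 1`, Euler `−1`, (iii) `q = 13`: `#Ẽ = 11`, `a = 3`, `u = 5`; the level `n = 197·239 = 47083 ∈ 𝒩₁(E,7)`:
`#Ẽ(𝔽_{197}) = 189` (kernel), `#Ẽ(𝔽_{239}) = 231` (kernel), both `≡ 0 (mod 7)`, `≢ 0 (mod 7²)`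
(cyclic `7`-torsion).
EVIDENCE (value binder `hδ`): `δ̃_{47083} ≡ 4 (mod 7)` — engine 1 = Bf kit j286086 (`D = 2`, rounding deviation `9.3e-09`, exact Hecke relations `434`/0 failed,
`[0]⁺ = 98` = BSD value); engine 2 (V41 exact twist, SAME level): kit j288123 N0=5925, δ̃_{47083} ≡ 4·c with c = 1 (|c|_7 = 1, exact from [0]), i.e. ≡ 4 (mod 7) — AGREE; V41 values {"47083": "4"}. Local torsion `E(ℚ_7)[7] = 0` (I₀* twist, `t = 0`: depth-one level is the printed case). Manin: `N ≤ 300000`, `|c_D| = 1` by the named database fact `h300`.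
CONDITIONAL on `hKim` (Kim 2026 Thm. 1.8 (6), PUBLISHED), GZK, modularity, Cremona's Manin computation (`h300`); per-row instance of crux 19357's conclusion on a `stub_irreducible` row; NOT a class theorem; nothing booked.
[cite: Kim2022StructureSelmer, Thm. 1.9 (6) (PDF p. 8), §1.2.2, §1.4.3] [cite: Serre1972, §2.8 Prop. 19] [cite: Cremona1997, Table 1 (label 290325bm1), §2.8] [cite: Miller2011LMS, Def. 1.1] -/
theorem gordTwoLower_kur_v290325bm1_7 (hKim : Kim2026.rankZero_le_padicValNat_sha_of_kuriharaNumber_ne_zero)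
    (hGZK : rank_eq_analyticRank_of_analyticRank_le_one) (hmod : hasEntireLFunction_rat)
    (h300 : cremona_abs_maninConstant_eq_one_of_level_le_300000)
    (W : WeierstrassCurve ℚ) (hW : W = ⟨1, 1, 0, 158661975, -1853359409250⟩)
    (hr : W.analyticRank = 0) (D : ModularParametrizationData W 290325)
    (hopt : ∀ z ∈ D.L.lattice, ∃ w ∈ periodLattice D.f, z = D.c * w)
    (hδ : ∃ ψ : (ℓ : ℕ) → (ZMod ℓ)ˣ →* Multiplicative (ZMod (7 ^ 1)),
      (∀ ℓ ∈ (197 * 239 : ℕ).primeFactors, Function.Surjective (ψ ℓ)) ∧ kuriharaNumber D.f (7 ^ 1) (197 * 239) ψ ≠ 0) :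
    MissingLowerBoundAt W 7 := by
  subst hW
  have hmin : (⟨1, 1, 0, 158661975, -1853359409250⟩ : WeierstrassCurve ℚ).IsGloballyMinimal :=
    isGloballyMinimal_of_krausCriterion_bounded 1 1 0 158661975 (-1853359409250)
      (by decide +kernel) (by decide +kernel) (by decide +kernel)
  haveI := hmin
  haveI : (⟨1, 1, 0, 158661975, -1853359409250⟩ : WeierstrassCurve ℚ).IsElliptic := isElliptic_of_discOf_ne_zero 1 1 0 158661975 (-1853359409250) (by decide +kernel)
  have hI : integralModelInt (⟨1, 1, 0, 158661975, -1853359409250⟩ : WeierstrassCurve ℚ) = (⟨1, 1, 0, 158661975, -1853359409250⟩ : WeierstrassCurve ℤ) :=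
    integralModelInt_eq_of_map_eq _ (map_mk_int 1 1 0 158661975 (-1853359409250))
  have hsurj : Surj (⟨1, 1, 0, 158661975, -1853359409250⟩ : WeierstrassCurve ℚ) 7 :=
    @surj_of_ainvs_of_serreWitnesses 1 1 0 158661975 (-1853359409250) 7 ⟨by norm_num⟩ (by norm_num) hmin
      17 11 13 (by norm_num) (by norm_num) (by norm_num) (by decide) (by decide) (by decide)
      (by decide) (by decide) (by decide) (by decide +kernel) (by decide +kernel) (by decide +kernel)
      (n₁ := 21) (n₂ := 11) (n₃ := 11) (by decide +kernel) (by decide +kernel) (by decide +kernel)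
      (5 : ZMod 7) (5 : ZMod 7) (by decide +kernel) (by decide +kernel) (by decide +kernel)
  -- the `Fact p.Prime` instance enters only now: the `decide` goals above must be closed terms
  haveI hp : Fact (Nat.Prime 7) := ⟨by norm_num⟩
  haveI : Fact (Nat.Prime 197) := ⟨by norm_num⟩
  haveI : Fact (Nat.Prime 239) := ⟨by norm_num⟩
  have hc₁ := natCard_point_eq_of_countPoints 1 1 0 158661975 (-1853359409250) 197 (by norm_num) (by decide +kernel) (n := 189) (by decide +kernel)
  have hc₂ := natCard_point_eq_of_countPoints 1 1 0 158661975 (-1853359409250) 239 (by norm_num) (by decide +kernel) (n := 231) (by decide +kernel)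
  have hk₁ : Kato.IsKolyvaginPrime (⟨1, 1, 0, 158661975, -1853359409250⟩ : WeierstrassCurve ℚ) 7 1 197 :=
    isKolyvaginPrime_of_intModel_of_card hI 7 1 197 (by norm_num) (by rw [intCurve_Δ]; decide +kernel) (by decide) hc₁ (by norm_num)
  have hk₂ : Kato.IsKolyvaginPrime (⟨1, 1, 0, 158661975, -1853359409250⟩ : WeierstrassCurve ℚ) 7 1 239 :=
    isKolyvaginPrime_of_intModel_of_card hI 7 1 239 (by norm_num) (by rw [intCurve_Δ]; decide +kernel) (by decide) hc₂ (by norm_num)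
  haveI : NeZero (197 * 239 : ℕ) := ⟨by norm_num⟩
  have hc : ¬ ((7 : ℕ) : ℤ) ∣ D.maninConstant :=
    not_dvd_maninConstant_of_level_le_300000 h300 _ D hopt (by norm_num) hp.out
  obtain ⟨ψ, hψ, hδ⟩ := hδ
  exact X4.missingLowerBoundAt_rankZero_of_kimLower _ 7 hKim hGZK (by norm_num) hsurj
    (((⟨1, 1, 0, 158661975, -1853359409250⟩ : WeierstrassCurve ℚ).analyticRank_eq_zero_iff_holds (hmod _)).mp hr) D hc (periodTransfer_of_optimal 7 D hopt hc)
    1 (197 * 239) le_rfl (Nat.le_add_left 1 _) (isKolyvaginProduct_mul hk₁ hk₂ (by norm_num))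
    (forall_card_torsion_le_of_pair hI 7 197 239 hc₁ hc₂ (by norm_num) (by norm_num)) ψ hψ hδ

/-- **`BSD(E,7)` for `E = 290325bm1`** from the Kurihara certificate: LOWER half = `gordTwoLower_kur_v290325bm1_7` (Kim 2026 Thm 1.8 (6), this file);
UPPER half = the cell's semistable-twist door `Addv.missingUpperBoundAt_rankZero_of_semistableTwist_of_surj` (Kato 2004 Thm 17.4 (3) in Wuthrich's
half-eigenspace reading `hK`, Delbourgo 1998 Prop 4 `hDel98`, Pal 2012 `hPal`, modularity `hmod`/`hmodD`; NO Tamagawa / Manin / partner hypothesis) with,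
IN THE KERNEL, `Addv W 7` (`7 ∣ Δ`, `7 ∣ c₄`), the twist model `V = [1, 0, 1, 3237999, 5403842773]` (`= E^{(-7)}` minimal, conductor `5925`: `Δ ≠ 0`, bounded Kraus form; `#Ṽ(𝔽_7) = 13`, `a_7 = -5`: good ORDINARY at `7`) and the explicit isomorphism
`⟨1, 1, 1/2, 0⟩ • V^{(-7)} = W` — i.e. the row lies in cell (G-ord, e = 2) = `N10.CellGordTwo` (crux 19357's domain, stub `stub_irreducible`).
Binders = those of `gordTwoLower_kur_v290325bm1_7` + `hK hDel98 hPal hmodD`. Booking-table currency shape of lane A's `bsdp_c<E>_<p>` with the certificate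
binder `hδ` (Kurihara VALUE, two engines) in place of `θ` / `hSel`. Per row; NOT a class theorem; nothing booked. BSD is not proved by any of this.
[cite: Kim2022StructureSelmer, Thm. 1.9 (6) (PDF p. 8)] [cite: Kato2004Asterisque, Thm. 17.4 (3) (p. 273)] [cite: Wuthrich2014, §3 (p. 390)] [cite: Delbourgo1998, Prop. 4 (p. 144)]
[cite: Pal2012, Thm. 3.2] [cite: Miller2011LMS, §1 and Def. 1.1] [cite: Cremona1997, Table 1 (label 290325bm1)] -/
theorem gordTwoBsdp_kur_v290325bm1_7 (hKim : Kim2026.rankZero_le_padicValNat_sha_of_kuriharaNumber_ne_zero)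
    (hGZK : rank_eq_analyticRank_of_analyticRank_le_one) (hmod : hasEntireLFunction_rat)
    (h300 : cremona_abs_maninConstant_eq_one_of_level_le_300000)
    (hK : Wuthrich2014.kato_halfEigenCharIdeal_dvd_cyclotomicPrime_of_surjective)
    (hDel98 : Delbourgo1998.prop4_rankZero_pow_dvd_constantCoeff)
    (hPal : Pal2012.thm32_sqrt_mul_realPeriodRat_twist_eq_of_prime_one_mod_four)
    (hmodD : nonempty_modularParametrizationData)
    (W : WeierstrassCurve ℚ) [W.IsElliptic] [W.IsGloballyMinimal] (hW : W = ⟨1, 1, 0, 158661975, -1853359409250⟩)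
    (hr : W.analyticRank = 0) (D : ModularParametrizationData W 290325)
    (hopt : ∀ z ∈ D.L.lattice, ∃ w ∈ periodLattice D.f, z = D.c * w)
    (hδ : ∃ ψ : (ℓ : ℕ) → (ZMod ℓ)ˣ →* Multiplicative (ZMod (7 ^ 1)),
      (∀ ℓ ∈ (197 * 239 : ℕ).primeFactors, Function.Surjective (ψ ℓ)) ∧ kuriharaNumber D.f (7 ^ 1) (197 * 239) ψ ≠ 0) :
    BSDp W 7 := by
  have hlow : MissingLowerBoundAt W 7 :=
    gordTwoLower_kur_v290325bm1_7 hKim hGZK hmod h300 W hW hr D hopt hδ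
  subst hW
  have hminW : (⟨1, 1, 0, 158661975, -1853359409250⟩ : WeierstrassCurve ℚ).IsGloballyMinimal :=
    isGloballyMinimal_of_krausCriterion_bounded 1 1 0 158661975 (-1853359409250)
      (by decide +kernel) (by decide +kernel) (by decide +kernel)
  have hIW : integralModelInt (⟨1, 1, 0, 158661975, -1853359409250⟩ : WeierstrassCurve ℚ) = (⟨1, 1, 0, 158661975, -1853359409250⟩ : WeierstrassCurve ℤ) :=
    integralModelInt_eq_of_map_eq _ (map_mk_int 1 1 0 158661975 (-1853359409250))
  have hsurj : Surj (⟨1, 1, 0, 158661975, -1853359409250⟩ : WeierstrassCurve ℚ) 7 :=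
    @surj_of_ainvs_of_serreWitnesses 1 1 0 158661975 (-1853359409250) 7 ⟨by norm_num⟩ (by norm_num) hminW
      17 11 13 (by norm_num) (by norm_num) (by norm_num) (by decide) (by decide) (by decide)
      (by decide) (by decide) (by decide) (by decide +kernel) (by decide +kernel) (by decide +kernel)
      (n₁ := 21) (n₂ := 11) (n₃ := 11) (by decide +kernel) (by decide +kernel) (by decide +kernel)
      (5 : ZMod 7) (5 : ZMod 7) (by decide +kernel) (by decide +kernel) (by decide +kernel)
  -- the `Fact p.Prime` instance enters only now: the `decide` goals above must be closed terms
  haveI hp : Fact (Nat.Prime 7) := ⟨by norm_num⟩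
  -- the good ordinary twist model V = E^(-7) (PARI ellminimalmodel(elltwist(E,-7)) = Connell's formulas on (c₄/p², ±c₆/p³)): Δ ≠ 0, Kraus minimality, GoodOrd at p — all kernel
  haveI hVell : (⟨1, 0, 1, 3237999, 5403842773⟩ : WeierstrassCurve ℚ).IsElliptic := isElliptic_of_discOf_ne_zero 1 0 1 3237999 5403842773 (by decide +kernel)
  haveI hVmin : (⟨1, 0, 1, 3237999, 5403842773⟩ : WeierstrassCurve ℚ).IsGloballyMinimal :=
    isGloballyMinimal_of_krausCriterion_bounded 1 0 1 3237999 5403842773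
    (by decide +kernel) (by decide +kernel) (by decide +kernel)
  have hVI : integralModelInt (⟨1, 0, 1, 3237999, 5403842773⟩ : WeierstrassCurve ℚ) = (⟨1, 0, 1, 3237999, 5403842773⟩ : WeierstrassCurve ℤ) :=
    integralModelInt_eq_of_map_eq _ (map_mk_int 1 0 1 3237999 5403842773)
  have hVc : Nat.card (((⟨1, 0, 1, 3237999, 5403842773⟩ : WeierstrassCurve ℤ).map (Int.castRingHom (ZMod 7))).toAffine.Point) = 13 := by
    have h := natCard_point_eq_countPoints 1 0 1 3237999 5403842773 7 (by norm_num) (by decide +kernel)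
    have h' : countPoints [1, 0, 1, 3237999, 5403842773] 7 = 13 := by decide +kernel
    exact_mod_cast h.trans h'
  have hVgood : GoodOrd (⟨1, 0, 1, 3237999, 5403842773⟩ : WeierstrassCurve ℚ) 7 := SecondDescent.goodOrd_of_intModel 7 hVI (by decide +kernel) hVc (by decide)
  have hadd : Addv (⟨1, 1, 0, 158661975, -1853359409250⟩ : WeierstrassCurve ℚ) 7 := Additive.addv_of_intModel hIW 7 (by decide +kernel) (by decide +kernel)
  have hWV : (⟨1, (1 : ℚ), ((1 : ℚ) / 2), (0 : ℚ)⟩ : VariableChange ℚ) • (⟨1, 0, 1, 3237999, 5403842773⟩ : WeierstrassCurve ℚ).quadraticTwist ((-1 : ℚ) ^ (7 / 2) * 7) = (⟨1, 1, 0, 158661975, -1853359409250⟩ : WeierstrassCurve ℚ) := by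
    ext <;> simp [WeierstrassCurve.variableChange_a₁, WeierstrassCurve.variableChange_a₂,
      WeierstrassCurve.variableChange_a₃, WeierstrassCurve.variableChange_a₄, WeierstrassCurve.variableChange_a₆,
      WeierstrassCurve.quadraticTwist, WeierstrassCurve.b₂, WeierstrassCurve.b₄, WeierstrassCurve.b₆] <;> norm_num
  exact bsdp_of_missingPPartAt _ 7 hGZK (by rw [hr]; norm_num)
    (missingPPartAt_of_lower_of_upper _ 7 hlow
      (Addv.missingUpperBoundAt_rankZero_of_semistableTwist_of_surj hK hDel98 hPal hGZK hmod hmodD (by norm_num)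
        hadd (⟨1, 0, 1, 3237999, 5403842773⟩ : WeierstrassCurve ℚ) (⟨1, (1 : ℚ), ((1 : ℚ) / 2), (0 : ℚ)⟩ : VariableChange ℚ) hWV (Or.inl hVgood) hsurj hr))

/-- **`BSD(E',7)` for every globally minimal `E'` `ℚ`-isogenous to `E = 290325bm1`** (Cremona class of 1 curve(s)): Cassels' invariance (`hCassels`,
`N10.bsdp_of_isIsogenous_of_bsdp`) on `gordTwoBsdp_kur_v290325bm1_7`. Per class; nothing booked. [cite: MilneADT2006, Thm. I.7.3 and Remark I.7.4]
[cite: Kim2022StructureSelmer, Thm. 1.9 (6) (PDF p. 8)] [cite: Kato2004Asterisque, Thm. 17.4 (3) (p. 273)] [cite: Miller2011LMS, §1 and Def. 1.1] -/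
theorem isogenous_gordTwoBsdp_kur_v290325bm1_7 (hCassels : bsdRHS_eq_of_isIsogenous)
    (hKim : Kim2026.rankZero_le_padicValNat_sha_of_kuriharaNumber_ne_zero)
    (hGZK : rank_eq_analyticRank_of_analyticRank_le_one) (hmod : hasEntireLFunction_rat)
    (h300 : cremona_abs_maninConstant_eq_one_of_level_le_300000)
    (hK : Wuthrich2014.kato_halfEigenCharIdeal_dvd_cyclotomicPrime_of_surjective)
    (hDel98 : Delbourgo1998.prop4_rankZero_pow_dvd_constantCoeff)
    (hPal : Pal2012.thm32_sqrt_mul_realPeriodRat_twist_eq_of_prime_one_mod_four)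
    (hmodD : nonempty_modularParametrizationData)
    (W : WeierstrassCurve ℚ) [W.IsElliptic] [W.IsGloballyMinimal] (hW : W = ⟨1, 1, 0, 158661975, -1853359409250⟩)
    (hr : W.analyticRank = 0) (D : ModularParametrizationData W 290325)
    (hopt : ∀ z ∈ D.L.lattice, ∃ w ∈ periodLattice D.f, z = D.c * w)
    (hδ : ∃ ψ : (ℓ : ℕ) → (ZMod ℓ)ˣ →* Multiplicative (ZMod (7 ^ 1)),
      (∀ ℓ ∈ (197 * 239 : ℕ).primeFactors, Function.Surjective (ψ ℓ)) ∧ kuriharaNumber D.f (7 ^ 1) (197 * 239) ψ ≠ 0)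
    {W' : WeierstrassCurve ℚ} [W'.IsElliptic] [W'.IsGloballyMinimal] (hiso : IsIsogenous W' W) :
    BSDp W' 7 := by
  haveI : Fact (Nat.Prime 7) := ⟨by norm_num⟩
  have hr' : W'.analyticRank ≤ 1 := by rw [analyticRank_eq_of_isIsogenous' hiso, hr]; exact zero_le_one
  exact N10.bsdp_of_isIsogenous_of_bsdp 7 hCassels hGZK hmod hiso hr'
    (gordTwoBsdp_kur_v290325bm1_7 hKim hGZK hmod h300 hK hDel98 hPal hmodD W hW hr D hopt hδ)

end Summit.BirchSwinnertonDyer.BirchSwinnertonDyer.Theorems.AdditiveBranchIMCGordTwoRankZeroKurihara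

end
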